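import Summits.QuantumFields.YangMills.Theorems.BalabanUVNodesK0Stub3SocketWindowEdition

/-!
# K0⁷ — STUB 3 LANE: THE β OF RECORD AND THE KERNEL OBJECTS ARE BLIND TO THE NORMALISATION TOKENS `Efl`, `logz` (kernel, `rfl`);
# hence FLAG №9's z-witness move (director-ym №218) costs the stub-3 currencies NOTHING — every box ∕ run ∕ kernel ∕ finite-volume letter at the collared witness IS the same
# statement at any normalised edition `{θ₁₅ᶜᶜᴹ(j; …) with Efl := E, logz := ℓ}`, and the registered socket texts are paid by boxes at ANY such edition

Cell `pub-ymgap`, width seat `pub-ymgap-k0-s3-w1` (g0-0; bus CLAIM-2 + INTENT-2 I.38795).  `--kind proof --supports stmt-QuantumFields-20541 --as helper`, COUNT-NEUTRAL.  NEW leaf over this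
seat's `…K0Stub3SocketWindowEdition` (p618788 ✓); theorems only — 0 `def`, 0 `sorry`; nothing modified; no registry write.
[I] = [Balaban1987RG1]; [III] = [Balaban1988Convergent]; [V] = [Balaban1989LargeFieldI].

WHY (FLAG №9, director-ym №218, 2026-08-28 13:10Z).  K0a's all-numerics witness family — `theta13OfThm1CCM ∕ …CCMW` — carries the normalisation tokens of [III] (1.15) as the ZERO
functions (`Record12NumericsFamilyDict` :113–114: `Efl := fun _ _ => 0`, `logz := fun _ _ => 0`), which makes it coupling-blind for the K1 face (N13); the cure of record is a z-witness
edition carrying print's `E_k`, `log z_k` (def-1 Z1 p637981 ✓, Z2 `Node00/Record13NumericsOfThm1CCMZ`), with «mechanical re-keys» downstream (№218 (3)).  For the STUB-3 lane the re-key is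
ONE kernel fact: the β of record `betaOfRecord₁₃ F N θ = betaOfRecord₈Tχ F N (TcanOfRecord F N) (chiFixed29 F N θ.ν θ.ε₂₉) θ.toStage8Params` ([I] (1.20)–(1.22) on the merged term
(1.6) with the (2.9) species) reads of `θ` ONLY `ν`, `ε₂₉`, `εbg`, the β-chart `(Vβ, ιβ, ρ8, bV)`, the base histories `v₀` and the window `γ` — NOT the Stage-7 fields `Efl`, `logz`
(they enter `EOfRecord₁₃`, the normalisation of `ρ₀`, which the β-layer never reads); the same for the merged term family, the kernel objects `objectsOfRecord₁₃` and W1's finite-volume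
letters of record.  So every currency of the lane at `θ₁₅ᶜᶜᴹ(j; …)` is LITERALLY the same proposition at `{θ₁₅ᶜᶜᴹ(j; …) with Efl := E, logz := ℓ}` for every `E ℓ` (§1, `rfl` ∕
`Iff.rfl`), and the registered socket texts — keyed at the blind family by the hard freeze (№216 (f); V20-G `stub_absBetaBoxAtThm1WitnessCCMGenG13` keeps `theta13OfThm1CCM`) — are paid by
boxes at ANY normalised edition (§2).  The Z2 makers `theta13OfThm1CCMZ … Efl logz` are expected to be such editions up to `rfl`; the one-line corollaries keyed at them follow when Z2
is in the tree (not imported here).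

CONTENTS (kernel-checked).
§1 θ-generic (`θ : Stage13Params F N`, `E ℓ : B12.RunParams → ℕ → ℝ`): ★ `betaOfRecord₁₃_update_Efl_logz` · `gOfRecord₁₃_update_Efl_logz` · `mergedTermFamily₁₃_update_Efl_logz` ·
   `objectsOfRecord₁₃_update_Efl_logz` · `polLimitsExistOfRecord₁₃_update_iff` · `polLimitsExistBoxOfRecord₁₃_update_iff` · `windowedNE9OfRecord₁₃_update_iff` · `windowedDecayOfRecord₁₃_update_iff` ·
   `kernelDecayOfRecord₁₃_update_iff` (all `rfl` ∕ `Iff.rfl`).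
§2 at the K0 witness families: `betaOfRecord₁₃_theta13OfThm1CCM_normalised` ∕ `…CCMW_normalised` (`rfl`) · ★★ `abs3A'_iff_boxAtNormalisedWitness` (V19's text ⟺ boxes at SOME normalised
   edition per admissible tuple — equivalently at ALL, the β being the same) · ★★ `abs3A'_of_ownWindowBoxAtNormalisedWindowWitness` (p618788's window edition at normalised window witnesses) ·
   ★★ `record13SepCoPHInhabited_of_stub1_boxAtNormalisedWitness_byName` (K0⁷ BY NAME with V19's stub-1 text; stub 2′ by name p595104).

HONEST FRAMING (binding).  `rfl`-level typing facts about which fields the β-layer reads + by-name transfers; NO β estimate; NO value of `E_k` ∕ `log z_k` pinned or used; nothing of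
Bałaban asserted; FLAG №9 is NOT closed by this (№218 (4) names its closing conditions); stub 3ᴬ′ (V19 ∕ V20-G text) NOT proved; K0⁷ stmt-QuantumFields-20541 OPEN (V20-G dead8a8df885c226
STANDS); counts unmoved (typed 28∕28 · discharged 5∕27 — the chair's words); no summit statement is proved by this seat; route R4 closes the CONDITIONAL finite-𝕋⁴ rung `BalabanLadder.UV`
only — NOTHING about the continuum limit, ℝ⁴, OS axioms, a mass gap or the Clay problem is proved or claimed.  No `sorry`, `def`, `instance`, `notation`, `axiom`; standard axioms.
-/

noncomputable section

open scoped Matrix.Norms.L2Operator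

namespace Summit.QuantumFields.YangMills.Theorems.K0Stub3NormalisationTokenBlind

open Literature.MathematicalPhysics.QuantumFieldTheory.Balaban1983to89
open Literature.MathematicalPhysics.QuantumFieldTheory.Balaban1983to89.Node00
open Literature.MathematicalPhysics.QuantumFieldTheory.Balaban1983to89.T4Continuum
open Literature.MathematicalPhysics.QuantumFieldTheory.Balaban1983to89.FlowStep
open Literature.MathematicalPhysics.QuantumFieldTheory.Balaban1983to89.Node00.U3OfKernels (objectsOfRecord₁₃ KernelDecayOfRecord₁₃)
open Literature.MathematicalPhysics.QuantumFieldTheory.Balaban1983to89.Node00.U3KernelLetters (PolLimitsExistOfRecord₁₃ PolLimitsExistBoxOfRecord₁₃ WindowedNE9OfRecord₁₃ WindowedDecayOfRecord₁₃)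
open Summit.QuantumFields.YangMills.Theorems.K0V19Defs (Prop8StepCoPAt AbsBetaBoxAtThm1WitnessCCMGenAt)
open Summit.QuantumFields.YangMills.Theorems.K0V19Stub2Prime (record13SepCoPHInhabited_of_stub1_stub3A'_byName)
open Summit.QuantumFields.YangMills.Theorems.K0Stub3SocketWindowEdition (abs3A'_of_ownWindowBoxAt)

/-! ## §1  θ-generic: updating the normalisation tokens `Efl`, `logz` changes neither β nor the kernel objects nor W1's letters of record -/

section Generic

variable (F : T4Family) (N : ℕ) [NeZero N] (θ : Stage13Params F N) (E ℓ : B12.RunParams → ℕ → ℝ)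

/-- **★ THE β OF RECORD IS BLIND TO `Efl`, `logz`** (`rfl`): [I] (1.20)–(1.22) on the merged term (1.6) read the background-field transport, the (2.9) species `chiFixed29 θ.ν θ.ε₂₉`, the
radius `εbg`, the β-chart and the window — never the normalisation tokens of [III] (1.15). [cite: Balaban1987RG1, (1.20)–(1.22) p.264, (1.6) p.261, (2.9) p.266; Balaban1988Convergent, (1.15) p.249 (the tokens not read)] -/
theorem betaOfRecord₁₃_update_Efl_logz : betaOfRecord₁₃ F N { θ with Efl := E, logz := ℓ } = betaOfRecord₁₃ F N θ := rfl

/-- Hence the GENERATED RUNS are blind to `Efl`, `logz` (`rfl`). [cite: Balaban1987RG1, (0.17)–(0.20) pp.255–256 (bookkeeping)] -/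
theorem gOfRecord₁₃_update_Efl_logz : gOfRecord₁₃ F N { θ with Efl := E, logz := ℓ } = gOfRecord₁₃ F N θ := rfl

/-- The MERGED TERM FAMILY OF RECORD (β-layer shape, matrix carrier) is blind to `Efl`, `logz` (`rfl`). [cite: Balaban1987RG1, (1.6) p.261, (1.20) p.264 (bookkeeping)] -/
theorem mergedTermFamily₁₃_update_Efl_logz :
    mergedTermFamilyMatT F N (TβOfRecord₁₃ F N) (chiβOfRecord₁₃ F N { θ with Efl := E, logz := ℓ }) ({ θ with Efl := E, logz := ℓ } : Stage13Params F N).εbg =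
      mergedTermFamilyMatT F N (TβOfRecord₁₃ F N) (chiβOfRecord₁₃ F N θ) θ.εbg := rfl

/-- Node U3's KERNEL OBJECTS OF RECORD are blind to `Efl`, `logz` (`rfl`). [cite: Balaban1987RG1, (1.20)–(1.22) p.264, (5.10) p.293 (bookkeeping)] -/
theorem objectsOfRecord₁₃_update_Efl_logz (lb : U3Letters₁₁) :
    objectsOfRecord₁₃ F N { θ with Efl := E, logz := ℓ } lb = objectsOfRecord₁₃ F N θ lb := rfl

/-- W1's (1.21) letter of record is blind to `Efl`, `logz` (`Iff.rfl`). [cite: Balaban1987RG1, (1.21) p.264 (bookkeeping)] -/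
theorem polLimitsExistOfRecord₁₃_update_iff :
    PolLimitsExistOfRecord₁₃ F N { θ with Efl := E, logz := ℓ } ↔ PolLimitsExistOfRecord₁₃ F N θ := Iff.rfl

/-- W1's (1.21) letter of record, BOX form, is blind to `Efl`, `logz` (`Iff.rfl`). [cite: Balaban1987RG1, (1.21) p.264 (bookkeeping)] -/
theorem polLimitsExistBoxOfRecord₁₃_update_iff :
    PolLimitsExistBoxOfRecord₁₃ F N { θ with Efl := E, logz := ℓ } ↔ PolLimitsExistBoxOfRecord₁₃ F N θ := Iff.rfl

/-- W1's windowed NE9 letter of record is blind to `Efl`, `logz` (`Iff.rfl`). [cite: Balaban1987RG1, (1.18) p.263 (bookkeeping)] -/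
theorem windowedNE9OfRecord₁₃_update_iff (κ : ℝ) (Λ : ℕ → ℕ → ℝ) :
    WindowedNE9OfRecord₁₃ F N { θ with Efl := E, logz := ℓ } κ Λ ↔ WindowedNE9OfRecord₁₃ F N θ κ Λ := Iff.rfl

/-- W1's windowed (5.10) letter of record is blind to `Efl`, `logz` (`Iff.rfl`). [cite: Balaban1987RG1, (5.10) p.293 (bookkeeping)] -/
theorem windowedDecayOfRecord₁₃_update_iff (μ ν : Fin 4) (κ : ℝ) :
    WindowedDecayOfRecord₁₃ F N { θ with Efl := E, logz := ℓ } μ ν κ ↔ WindowedDecayOfRecord₁₃ F N θ μ ν κ := Iff.rfl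

/-- The (D4) letter of record (limiting-kernel (5.10) decay) is blind to `Efl`, `logz` (`Iff.rfl`). [cite: Balaban1987RG1, (5.10) p.293 (bookkeeping)] -/
theorem kernelDecayOfRecord₁₃_update_iff (μ ν : Fin 4) (κ : ℝ) :
    KernelDecayOfRecord₁₃ F N { θ with Efl := E, logz := ℓ } μ ν κ ↔ KernelDecayOfRecord₁₃ F N θ μ ν κ := Iff.rfl

end Generic

/-! ## §2  At the K0 witness families: normalised editions carry the SAME β; the registered socket text is paid by boxes at any normalised edition -/

section Witness

variable (F : T4Family)

/-- **The collared witness with ANY normalisation tokens has the β of the collared witness** (`rfl`). [cite: Balaban1987RG1, (1.20)–(1.22) p.264; Balaban1988Convergent, (1.15) p.249 (bookkeeping)] -/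
theorem betaOfRecord₁₃_theta13OfThm1CCM_normalised (N : ℕ) [NeZero N] (j : ℕ) (ε₀ ε₂₉ B₃ B₃' a₀ a₁ : ℝ) (E ℓ : B12.RunParams → ℕ → ℝ) :
    betaOfRecord₁₃ F N { theta13OfThm1CCM F N j ε₀ ε₂₉ B₃ B₃' a₀ a₁ with Efl := E, logz := ℓ } =
      betaOfRecord₁₃ F N (theta13OfThm1CCM F N j ε₀ ε₂₉ B₃ B₃' a₀ a₁) := rfl

/-- **… and likewise for the window witness `θ₁₅ᶜᶜᴹᵂ(j; γ)`** (`rfl`). [cite: Balaban1987RG1, (1.20)–(1.22) p.264 (bookkeeping)] -/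
theorem betaOfRecord₁₃_theta13OfThm1CCMW_normalised (N : ℕ) [NeZero N] (j : ℕ) (γ ε₀ ε₂₉ B₃ B₃' a₀ a₁ : ℝ) (E ℓ : B12.RunParams → ℕ → ℝ) :
    betaOfRecord₁₃ F N { theta13OfThm1CCMW F N j γ ε₀ ε₂₉ B₃ B₃' a₀ a₁ with Efl := E, logz := ℓ } =
      betaOfRecord₁₃ F N (theta13OfThm1CCMW F N j γ ε₀ ε₂₉ B₃ B₃' a₀ a₁) := rfl

/-- **★★ V19's SOCKET TEXT ⟺ BOXES AT SOME NORMALISED EDITION OF THE COLLARED WITNESS** per admissible tuple (`E ℓ` the supplier's — e.g. print's `E_k`, `log z_k` of the z-witness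
edition): both directions are the identity on the box, the β being the same term (§1).  So a NODE O ∕ N22 supplier working at a non-blind (FLAG №9-cured) witness pays the registered text
unchanged, and nothing landed in the stub-3 lane needs re-typing for the z-move. [cite: Balaban1987RG1, Thm 1 p.255, (1.20)–(1.22) p.264, §1 p.264; Balaban1985Variational, Thm 1 (8)–(9) p.279; Balaban1988Convergent, (1.15) p.249, Thm 1 p.262] -/
theorem abs3A'_iff_boxAtNormalisedWitness :
    AbsBetaBoxAtThm1WitnessCCMGenAt F ↔
      ∀ (j c : ℕ) (B₃ B₃' a₀ a₁ : ℝ), c ≤ F.L ^ j → 2 * (F.L : ℝ) ^ 2 ≤ B₃ → 0 < B₃' → 0 < a₀ → 0 < a₁ →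
        VariationalThm1RegSepCoP7M F 2 B₃ a₀ a₁ →
        Gauge9RegSepTopStepR F 2 (fun ν K Ω => suppDomOfRecord F ν K Ω) (F.L ^ j) c B₃ B₃' a₀ a₁ →
        ∃ (E ℓ : B12.RunParams → ℕ → ℝ) (γ₀ ε₀ ε₂₉ β' : ℝ), 0 < γ₀ ∧ 0 < ε₀ ∧ 0 < ε₂₉ ∧
          BetaLowerH (-β') γ₀ (betaOfRecord₁₃ F 2 { theta13OfThm1CCM F 2 j ε₀ ε₂₉ B₃ B₃' a₀ a₁ with Efl := E, logz := ℓ }) ∧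
          BetaUpperH β' γ₀ (betaOfRecord₁₃ F 2 { theta13OfThm1CCM F 2 j ε₀ ε₂₉ B₃ B₃' a₀ a₁ with Efl := E, logz := ℓ }) := by
  constructor
  · intro h j c B₃ B₃' a₀ a₁ hc hB hB' ha₀ ha₁ h15 h9
    obtain ⟨γ₀, ε₀, ε₂₉, β', hγ₀, hε, hε', hlow, hup⟩ := h j c B₃ B₃' a₀ a₁ hc hB hB' ha₀ ha₁ h15 h9
    exact ⟨fun _ _ => 0, fun _ _ => 0, γ₀, ε₀, ε₂₉, β', hγ₀, hε, hε', hlow, hup⟩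
  · intro h j c B₃ B₃' a₀ a₁ hc hB hB' ha₀ ha₁ h15 h9
    obtain ⟨E, ℓ, γ₀, ε₀, ε₂₉, β', hγ₀, hε, hε', hlow, hup⟩ := h j c B₃ B₃' a₀ a₁ hc hB hB' ha₀ ha₁ h15 h9
    exact ⟨γ₀, ε₀, ε₂₉, β', hγ₀, hε, hε', hlow, hup⟩

/-- **★★ THE WINDOW EDITION AT NORMALISED WINDOW WITNESSES** — own-window boxes of `{θ₁₅ᶜᶜᴹᵂ(j; γ₀, …) with Efl := E, logz := ℓ}`, `0 < γ₀ ≤ ½`, for SOME `E ℓ γ₀ ε₀ ε₂₉ β′` per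
admissible tuple ⟹ V19's socket text (§1 + p618788 `abs3A'_of_ownWindowBoxAt`): the shape a θ-generic road run at a SMALL-window, NORMALISED record returns.  CONDITIONAL on the boxes.
[cite: Balaban1987RG1, Thm 1 p.255, (1.20)–(1.22) p.264, §1 p.264; Balaban1989LargeFieldII, (1.4) p.357; Balaban1988Convergent, (1.15) p.249] -/
theorem abs3A'_of_ownWindowBoxAtNormalisedWindowWitness
    (h : ∀ (j c : ℕ) (B₃ B₃' a₀ a₁ : ℝ), c ≤ F.L ^ j → 2 * (F.L : ℝ) ^ 2 ≤ B₃ → 0 < B₃' → 0 < a₀ → 0 < a₁ →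
      VariationalThm1RegSepCoP7M F 2 B₃ a₀ a₁ →
      Gauge9RegSepTopStepR F 2 (fun ν K Ω => suppDomOfRecord F ν K Ω) (F.L ^ j) c B₃ B₃' a₀ a₁ →
      ∃ (E ℓ : B12.RunParams → ℕ → ℝ) (γ₀ ε₀ ε₂₉ β' : ℝ), 0 < γ₀ ∧ γ₀ ≤ 1 / 2 ∧ 0 < ε₀ ∧ 0 < ε₂₉ ∧
        BetaLowerH (-β') ({ theta13OfThm1CCMW F 2 j γ₀ ε₀ ε₂₉ B₃ B₃' a₀ a₁ with Efl := E, logz := ℓ } : Stage13Params F 2).γ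
          (betaOfRecord₁₃ F 2 { theta13OfThm1CCMW F 2 j γ₀ ε₀ ε₂₉ B₃ B₃' a₀ a₁ with Efl := E, logz := ℓ }) ∧
        BetaUpperH β' ({ theta13OfThm1CCMW F 2 j γ₀ ε₀ ε₂₉ B₃ B₃' a₀ a₁ with Efl := E, logz := ℓ } : Stage13Params F 2).γ
          (betaOfRecord₁₃ F 2 { theta13OfThm1CCMW F 2 j γ₀ ε₀ ε₂₉ B₃ B₃' a₀ a₁ with Efl := E, logz := ℓ })) :
    AbsBetaBoxAtThm1WitnessCCMGenAt F := by
  refine abs3A'_of_ownWindowBoxAt F fun j c B₃ B₃' a₀ a₁ hc hB hB' ha₀ ha₁ h15 h9 => ?_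
  obtain ⟨E, ℓ, γ₀, ε₀, ε₂₉, β', hγ₀, hγh, hε, hε', hlow, hup⟩ := h j c B₃ B₃' a₀ a₁ hc hB hB' ha₀ ha₁ h15 h9
  exact ⟨γ₀, ε₀, ε₂₉, β', hγ₀, hγh, hε, hε', hlow, hup⟩

/-- **★★ K0⁷ BY NAME FROM V19's STUB-1 TEXT AND BOXES AT NORMALISED EDITIONS OF THE COLLARED WITNESS** (stub 2′ by name inside
`K0V19Stub2Prime.record13SepCoPHInhabited_of_stub1_stub3A'_byName`, p595104).  CONDITIONAL on `h1` and the boxes; K0⁷ OPEN (V20-G registered: the V20 twin is k0-s3-w2's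
`K0Stub3V20GSockets` fed through the token-free core); a helper, not a closer. [cite: Balaban1985Variational, Thm 1 (8)–(9) p.279, Prop. 8 p.304; Balaban1985RegularSpaces, Prop. 6 p.99; Balaban1988Convergent, (1.15) p.249, Thm 1 p.262; Balaban1987RG1, Thm 1 p.255, §1 p.264] -/
theorem record13SepCoPHInhabited_of_stub1_boxAtNormalisedWitness_byName (h1 : ∀ F : T4Family, Prop8StepCoPAt F)
    (h : ∀ (F : T4Family) (j c : ℕ) (B₃ B₃' a₀ a₁ : ℝ), c ≤ F.L ^ j → 2 * (F.L : ℝ) ^ 2 ≤ B₃ → 0 < B₃' → 0 < a₀ → 0 < a₁ →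
      VariationalThm1RegSepCoP7M F 2 B₃ a₀ a₁ →
      Gauge9RegSepTopStepR F 2 (fun ν K Ω => suppDomOfRecord F ν K Ω) (F.L ^ j) c B₃ B₃' a₀ a₁ →
      ∃ (E ℓ : B12.RunParams → ℕ → ℝ) (γ₀ ε₀ ε₂₉ β' : ℝ), 0 < γ₀ ∧ 0 < ε₀ ∧ 0 < ε₂₉ ∧
        BetaLowerH (-β') γ₀ (betaOfRecord₁₃ F 2 { theta13OfThm1CCM F 2 j ε₀ ε₂₉ B₃ B₃' a₀ a₁ with Efl := E, logz := ℓ }) ∧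
        BetaUpperH β' γ₀ (betaOfRecord₁₃ F 2 { theta13OfThm1CCM F 2 j ε₀ ε₂₉ B₃ B₃' a₀ a₁ with Efl := E, logz := ℓ })) :
    Summit.QuantumFields.YangMills.Theses.BalabanUVNodes.Record13SepCoPHInhabited :=
  record13SepCoPHInhabited_of_stub1_stub3A'_byName h1 fun F => (abs3A'_iff_boxAtNormalisedWitness F).2 (h F)

end Witness

end Summit.QuantumFields.YangMills.Theorems.K0Stub3NormalisationTokenBlind

end
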